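import Literature.Geometry.Lorentzian.SurfaceTransgression
import Literature.Geometry.Lorentzian.ConformalCoordCurvature
import HarnessLib

/-!
# The scalar-curvature identities of a gradient shrinking Ricci soliton
(stub `stub_shrinkerScalarIdentities` of line `cgy-variance-pivot`, crux
`EntropyRung.CompactShrinkerGap`, item stmt-SmoothPoincare4-10870)

For a metric `g` (Levi-Civita connection) and a smooth `f` with `Ric + Hess f = g/2`:
(A) `dR(v) = 2 Ric(♯df, v)`; (B) `ΔR = g⁻¹(dR, df) + R − 2|Ric|²` (Hamilton 1995, §20;
Eminenti–La Nave–Mantegazza, Prop. 2.2; Cheng–Ribeiro–Zhou, Lemma 1). Both are local and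
tensorial: they are first proved for METRIC COMPONENTS `G` (`MetricCoord.IsMetricOn G V`) and a
smooth `φ` with `ricAt G + hessAt G φ = ½ G` on `V`, by the Fréchet calculus of
`Literature/Geometry/Lorentzian/Coord*.lean` — the contracted Bianchi identity `dS = 2 div Ric`
(`IsMetricOn.fderiv_scalAt'`), the divergence of the Hessian `div Hess φ = dΔφ + Ric(♯dφ, ·)`
(`IsMetricOn.sum_ginv_cov₂At_hessAt`), the traced equation `S + Δφ = n/2`, and for (B) one more
derivative of (A) with `∂(♯dφ) = ♯Hess φ − Γ♯dφ` — and then transported to the manifold through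
the chart at the point (`chartInv`/`chartRep`; the bridges `scalarCurvature_chartInv_eq`,
`dalembertian_chartInv_eq`, `innerDual_chartInv_eq`, `ricci_comap_apply`, `hessian_comap_apply`,
`OpensChart.*_eq_*At`). Everything is proved; no definition, no named fact.

References: M. Eminenti, G. La Nave, C. Mantegazza, *Ricci solitons: the equation point of
view*, Manuscripta Math. 127 (2008), Prop. 2.2 [EminentiNaveMantegazza2006]; X. Cheng,
E. Ribeiro Jr, D. Zhou, arXiv:2203.14916, Lemma 1 [ChengRibeiroZhou2022]; B. O'Neill,
*Semi-Riemannian geometry* (1983), Ch. 3, Cor. 3.54, Prop. 3.59 [ONeill1983].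
-/

noncomputable section

-- nested operator spaces `E →L E →L ℝ` of metric components, as in `CoordCurvature.lean`
set_option maxSynthPendingDepth 3
-- the registered namespace `Summit.SmoothPoincare4.SmoothPoincare4.Theorems` repeats a component
set_option linter.dupNamespace false

open Bundle Set Function Filter Module TopologicalSpace
open scoped Manifold ContDiff Topology

namespace Summit.SmoothPoincare4.SmoothPoincare4.Theorems

open Literature.Geometry Literature.Geometry.Lorentzian Literature.Geometry.Riemannian
  Literature.Geometry.Lorentzian.MetricCoord Literature.Geometry.Lorentzian.PseudoRiemannianMetric

namespace ShrinkerIdentities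

/-! ### The identities for metric components -/

section Coord

variable {E : Type*} [NormedAddCommGroup E] [NormedSpace ℝ E] [FiniteDimensional ℝ E]
  {G : E → E →L[ℝ] E →L[ℝ] ℝ} {V : Set E} {x : E} {φ : E → ℝ}

/-- **`∇Ric = −∇Hess φ` on a gradient shrinker**: `Ric(G) + Hess_G φ = ½ G` on `V` gives
`(∇_W Ric)(Y,Z) = −(∇_W Hess φ)(Y,Z)` at the points of `V` (`∇G = 0`, O'Neill 1983, Ch. 3,
Prop. 3.13). [cite: EminentiNaveMantegazza2006, Prop. 2.2] -/
theorem cov₂At_ricAt (hG : IsMetricOn G V) (hx : x ∈ V) (hφ : ContDiffOn ℝ ∞ φ V)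
    (hsol : ∀ y ∈ V, ∀ v w : E, ricAt G y v w + hessAt G φ y v w = (1 / 2 : ℝ) * G y v w)
    (W Y Z : E) :
    cov₂At G (ricAt G) x W Y Z = -cov₂At G (hessAt G φ) x W Y Z := by
  have heq : ricAt G =ᶠ[𝓝 x] fun y ↦ (1 / 2 : ℝ) • G y - hessAt G φ y := by
    filter_upwards [hG.mem_nhds hx] with y hy
    ext v w
    have h := hsol y hy v w
    simp only [_root_.sub_apply, _root_.smul_apply, smul_eq_mul]
    linarith
  have hGd := hG.differentiableAt hx
  rw [cov₂At_congr heq]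
  simp only [cov₂At_apply]
  rw [fderiv_fun_sub (hGd.fun_const_smul _) (hG.differentiableAt_hessAt hx hφ),
    fderiv_fun_const_smul hGd]
  simp only [_root_.sub_apply, _root_.smul_apply, smul_eq_mul, hG.fderiv_eq_chrAt hx W Y Z]
  ring

/-- **The traced soliton equation `S + Δφ = n/2`** (`tr_G Ric = S`, `tr_G Hess φ = Δφ`,
`tr_G G = n`). [cite: EminentiNaveMantegazza2006, Prop. 2.2] -/
theorem scalAt_add_lapAt (hG : IsMetricOn G V) (hx : x ∈ V)
    (hsol : ∀ y ∈ V, ∀ v w : E, ricAt G y v w + hessAt G φ y v w = (1 / 2 : ℝ) * G y v w) :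
    scalAt G x + lapAt G φ x = (finrank ℝ E : ℝ) / 2 := by
  have hsum : ricAt G x + hessAt G φ x = (1 / 2 : ℝ) • G x := by
    ext v w
    simp only [_root_.add_apply, _root_.smul_apply, smul_eq_mul]
    exact hsol x hx v w
  rw [scalAt, lapAt, ← mtrAt_add, hsum, mtrAt_smul, mtrAt_self (hG.isInvertible x hx)]
  ring

/-- **Identity (A) for the components: `dS(Y) = 2 Ric(♯dφ, Y)`.** The contracted Bianchi
identity `dS(Y) = 2 Σ g^{kl} (∇_{b_k} Ric)(b_l, Y)`, `∇Ric = −∇Hess φ`, the divergence of the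
Hessian `Σ g^{kl}(∇_{b_k} Hess φ)(b_l, Y) = dΔφ(Y) + Ric(♯dφ, Y)` and `dΔφ = −dS`.
[cite: EminentiNaveMantegazza2006, Prop. 2.2] [cite: ChengRibeiroZhou2022, Lemma 1] -/
theorem fderiv_scalAt (hG : IsMetricOn G V) (hx : x ∈ V) (hφ : ContDiffOn ℝ ∞ φ V)
    (hsol : ∀ y ∈ V, ∀ v w : E, ricAt G y v w + hessAt G φ y v w = (1 / 2 : ℝ) * G y v w)
    (Y : E) :
    fderiv ℝ (scalAt G) x Y = 2 * ricAt G x (sharpAt G x (fderiv ℝ φ x)) Y := by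
  set b := Module.finBasis ℝ E
  have h1 := hG.fderiv_scalAt' b hx Y
  have h2 : ∑ k, ∑ l, ginv G b x k l * cov₂At G (ricAt G) x (b k) (b l) Y =
      -(∑ k, ∑ l, ginv G b x k l * cov₂At G (hessAt G φ) x (b k) (b l) Y) := by
    rw [← Finset.sum_neg_distrib]
    refine Finset.sum_congr rfl fun k _ ↦ ?_
    rw [← Finset.sum_neg_distrib]
    refine Finset.sum_congr rfl fun l _ ↦ ?_
    rw [cov₂At_ricAt hG hx hφ hsol]
    ring
  have h3 := hG.sum_ginv_cov₂At_hessAt b hx hφ Y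
  have h4 : fderiv ℝ (lapAt G φ) x Y = -fderiv ℝ (scalAt G) x Y := by
    have heq : lapAt G φ =ᶠ[𝓝 x] fun y ↦ (finrank ℝ E : ℝ) / 2 - scalAt G y := by
      filter_upwards [hG.mem_nhds hx] with y hy
      linarith [scalAt_add_lapAt hG hy hsol]
    rw [heq.fderiv_eq, fderiv_const_sub, _root_.neg_apply]
  linarith

/-- **The Hessian of the scalar curvature of a gradient shrinker**: differentiating (A) once
more, with `∂_Y(♯dφ) = ♯Hess φ(Y,·) − Γ_Y ♯dφ` (`IsMetricOn.fderiv_sharpAt_fderiv_apply`),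
`Hess S (Y, Z) = 2 (∇_Y Ric)(♯dφ, Z) + 2 Ric(♯ Hess φ(Y,·), Z)`.
[cite: EminentiNaveMantegazza2006, Prop. 2.2] -/
theorem hessAt_scalAt (hG : IsMetricOn G V) (hx : x ∈ V) (hφ : ContDiffOn ℝ ∞ φ V)
    (hsol : ∀ y ∈ V, ∀ v w : E, ricAt G y v w + hessAt G φ y v w = (1 / 2 : ℝ) * G y v w)
    (Y Z : E) :
    hessAt G (scalAt G) x Y Z =
      2 * cov₂At G (ricAt G) x Y (sharpAt G x (fderiv ℝ φ x)) Z
        + 2 * ricAt G x (sharpAt G x (hessAt G φ x Y)) Z := by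
  -- `dS = 2 Ric(u, ·)` near `x`, `u = ♯dφ`
  have heq : fderiv ℝ (scalAt G) =ᶠ[𝓝 x]
      fun y ↦ (2 : ℝ) • ricAt G y (sharpAt G y (fderiv ℝ φ y)) := by
    filter_upwards [hG.mem_nhds hx] with y hy
    ext Y'
    rw [fderiv_scalAt hG hy hφ hsol Y', _root_.smul_apply, smul_eq_mul]
  have hu := hG.hasFDerivAt_sharpAt_fderiv hx hφ
  have hd : HasFDerivAt (fun y ↦ (2 : ℝ) • ricAt G y (sharpAt G y (fderiv ℝ φ y)))
      ((2 : ℝ) • ((ricAt G x).comp ((sharpAt G x).comp (fderiv ℝ (fderiv ℝ φ) x) +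
        (fderiv ℝ (sharpAt G) x).flip (fderiv ℝ φ x)) +
        (fderiv ℝ (ricAt G) x).flip (sharpAt G x (fderiv ℝ φ x)))) x :=
    ((hG.differentiableAt_ricAt hx).hasFDerivAt.clm_apply hu).const_smul (2 : ℝ)
  -- the derivative of the gradient field `u`
  have hu' : sharpAt G x (fderiv ℝ (fderiv ℝ φ) x Y) + fderiv ℝ (sharpAt G) x Y (fderiv ℝ φ x) =
      sharpAt G x (hessAt G φ x Y) - chrAt G x Y (sharpAt G x (fderiv ℝ φ x)) := by
    have h := hG.fderiv_sharpAt_fderiv_apply hx hφ Y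
    rw [hu.fderiv] at h
    simpa only [_root_.add_apply, ContinuousLinearMap.comp_apply,
      ContinuousLinearMap.flip_apply] using h
  have hD2 : fderiv ℝ (fderiv ℝ (scalAt G)) x Y Z =
      2 * (ricAt G x (sharpAt G x (hessAt G φ x Y) - chrAt G x Y (sharpAt G x (fderiv ℝ φ x))) Z
        + fderiv ℝ (ricAt G) x Y (sharpAt G x (fderiv ℝ φ x)) Z) := by
    rw [heq.fderiv_eq, hd.fderiv]
    simp only [_root_.smul_apply, _root_.add_apply, ContinuousLinearMap.comp_apply,
      ContinuousLinearMap.flip_apply, smul_eq_mul]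
    rw [← hu', map_add, _root_.add_apply]
  -- the derivative of the Ricci field through `∇Ric`
  have hc : fderiv ℝ (ricAt G) x Y (sharpAt G x (fderiv ℝ φ x)) Z =
      cov₂At G (ricAt G) x Y (sharpAt G x (fderiv ℝ φ x)) Z
        + ricAt G x (chrAt G x Y (sharpAt G x (fderiv ℝ φ x))) Z
        + ricAt G x (sharpAt G x (fderiv ℝ φ x)) (chrAt G x Y Z) := by
    rw [cov₂At_apply]
    ring
  rw [hessAt_apply, hD2, hc, fderiv_scalAt hG hx hφ hsol (chrAt G x Y Z), map_sub,
    _root_.sub_apply]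
  ring

/-- **Identity (B) for the components: `ΔS = dS(♯dφ) + S − 2|Ric|²`.** Trace `hessAt_scalAt`:
the first term contracts to `dS(♯dφ)` by the contracted Bianchi identity again, the second to
`2 Σ g^{kl} Ric(♯(½G − Ric)(b_k,·), b_l) = S − 2|Ric|²`.
[cite: EminentiNaveMantegazza2006, Prop. 2.2] [cite: ChengRibeiroZhou2022, Lemma 1] -/
theorem lapAt_scalAt (hG : IsMetricOn G V) (hx : x ∈ V) (hφ : ContDiffOn ℝ ∞ φ V)
    (hsol : ∀ y ∈ V, ∀ v w : E, ricAt G y v w + hessAt G φ y v w = (1 / 2 : ℝ) * G y v w) :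
    lapAt G (scalAt G) x =
      fderiv ℝ (scalAt G) x (sharpAt G x (fderiv ℝ φ x)) + scalAt G x
        - 2 * normSqAt G x (ricAt G x) := by
  set b := Module.finBasis ℝ E
  have hi := hG.isInvertible x hx
  set u := sharpAt G x (fderiv ℝ φ x) with hu
  -- symmetry of `∇Ric` in its last two slots
  have hRs : ∀ᶠ y in 𝓝 x, ∀ v w, ricAt G y v w = ricAt G y w v := by
    filter_upwards [hG.mem_nhds hx] with y hy v w using hG.ricAt_comm hy v w
  have hsym : ∀ W Y Z, cov₂At G (ricAt G) x W Y Z = cov₂At G (ricAt G) x W Z Y :=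
    cov₂At_symm (hG.differentiableAt_ricAt hx) hRs
  -- `♯ Hess φ(Y,·) = ½ Y − ♯ Ric(Y,·)`
  have hsharp : ∀ Y,
      sharpAt G x (hessAt G φ x Y) = (1 / 2 : ℝ) • Y - sharpAt G x (ricAt G x Y) := by
    intro Y
    have h : hessAt G φ x Y = (1 / 2 : ℝ) • G x Y - ricAt G x Y := by
      ext w
      have := hsol x hx Y w
      simp only [_root_.sub_apply, _root_.smul_apply, smul_eq_mul]
      linarith
    rw [h, map_sub, map_smul, sharpAt_apply hi]
  have hterm : ∀ k l, ginv G b x k l * (2 * cov₂At G (ricAt G) x (b k) u (b l)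
      + 2 * ricAt G x (sharpAt G x (hessAt G φ x (b k))) (b l)) =
      2 * (ginv G b x k l * cov₂At G (ricAt G) x (b k) (b l) u)
        + ginv G b x k l * ricAt G x (b k) (b l)
        - 2 * (ginv G b x k l * ricAt G x (b l) (sharpAt G x (ricAt G x (b k)))) := by
    intro k l
    rw [hsym (b k) u (b l), hsharp (b k), map_sub, map_smul, _root_.sub_apply,
      _root_.smul_apply, smul_eq_mul, hG.ricAt_comm hx (sharpAt G x (ricAt G x (b k))) (b l)]
    ring
  rw [lapAt, mtrAt_eq_sum b]
  simp only [hessAt_scalAt hG hx hφ hsol]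
  rw [Finset.sum_congr rfl fun k _ ↦ Finset.sum_congr rfl fun l _ ↦ hterm k l]
  simp only [Finset.sum_add_distrib, Finset.sum_sub_distrib, ← Finset.mul_sum]
  rw [← scalAt_eq_sum b, ← hG.fderiv_scalAt' b hx u,
    ← hG.normSqAt_eq_sum_of_symm b hx (hG.ricAt_comm hx)]

end Coord

/-! ### Transport to the manifold through the chart at a point -/

section Transport

variable {E : Type*} [NormedAddCommGroup E] [NormedSpace ℝ E] [FiniteDimensional ℝ E]
  {H : Type*} [TopologicalSpace H] {I : ModelWithCorners ℝ E H} [I.Boundaryless]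
  {M : Type*} [TopologicalSpace M] [ChartedSpace H M] [IsManifold I ∞ M]

omit [FiniteDimensional ℝ E] in
/-- **The differential of a function read in the chart**: `dF_{Φ u}(dΦ_u v) = DF̂(u) v` for the
representative `F̂ = F ∘ (extChartAt I x₀)⁻¹` and `Φ = chartInv I x₀` (chain rule). [folklore] -/
theorem mvfderiv_chartInv_apply (x₀ : M) (u : chartTarget I x₀) {F : M → ℝ}
    (hF : MDifferentiableAt I 𝓘(ℝ, ℝ) F (chartInv I x₀ u)) (v : E) :
    mvfderiv I F (chartInv I x₀ u) (mfderiv 𝓘(ℝ, E) I (chartInv I x₀) u v) =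
      fderiv ℝ (F ∘ (extChartAt I x₀).symm) u v := by
  have hΦd : MDifferentiableAt 𝓘(ℝ, E) I (chartInv I x₀) u :=
    ((contMDiff_chartInv x₀).of_le le_self_add u).mdifferentiableAt (by simp)
  rw [← mvfderiv_comp_apply hF hΦd v]
  exact LinearMap.congr_fun (mvfderiv_comp_chartInv_toLinearMap x₀ u hF) v

variable (g : PseudoRiemannianMetric I ∞ E (TangentSpace I : M → Type _))

/-- **The gradient read in the chart**: `♯_g dF (Φ u) = dΦ_u (♯_G DF̂(u))` — both sides have the
same `g`-products with every `dΦ_u w` (`g(dΦ a, dΦ w) = G(a, w)`, `G(♯β, w) = β w = dF(dΦ w)`),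
and `dΦ_u` is onto. [cite: ONeill1983, Ch. 3, p. 60 and Prop. 3.59] -/
theorem sharp_mvfderiv_chartInv_eq (x₀ : M) (u : chartTarget I x₀) {F : M → ℝ}
    (hF : MDifferentiableAt I 𝓘(ℝ, ℝ) F (chartInv I x₀ u)) :
    g.sharp (chartInv I x₀ u)
        (mvfderiv I F (chartInv I x₀ u) : TangentSpace I (chartInv I x₀ u) →ₗ[ℝ] ℝ) =
      mfderiv 𝓘(ℝ, E) I (chartInv I x₀) u
        (sharpAt (chartRep I (fun _ ↦ g) x₀ 0) u (fderiv ℝ (F ∘ (extChartAt I x₀).symm) u)) := by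
  have hG := val_chartPullback_eq_chartRep (fun _ : ℝ ↦ g) x₀ 0
  have hGm : IsMetricOn (chartRep I (fun _ ↦ g) x₀ 0) (extChartAt I x₀).target :=
    Lorentzian.OpensChart.isMetricOn_repr hG
  refine g.sharp_eq_of_forall (chartInv I x₀ u) _ _ fun w ↦ ?_
  obtain ⟨w', rfl⟩ : ∃ w' : E, mfderiv 𝓘(ℝ, E) I (chartInv I x₀) u w' = w :=
    ⟨(mfderivEquivOfInjective (I := I) (I' := 𝓘(ℝ, E)) (chartInv I x₀) u
      (injective_mfderiv_chartInv x₀ u) rfl).symm w,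
      mfderiv_mfderivEquivOfInjective_symm _ _ _ _ w⟩
  have h1 : g.val (chartInv I x₀ u)
      (mfderiv 𝓘(ℝ, E) I (chartInv I x₀) u (sharpAt (chartRep I (fun _ ↦ g) x₀ 0) u
        (fderiv ℝ (F ∘ (extChartAt I x₀).symm) u)))
      (mfderiv 𝓘(ℝ, E) I (chartInv I x₀) u w') =
      chartRep I (fun _ ↦ g) x₀ 0 u (sharpAt (chartRep I (fun _ ↦ g) x₀ 0) u
        (fderiv ℝ (F ∘ (extChartAt I x₀).symm) u)) w' :=
    (chartRep_apply (fun _ ↦ g) x₀ 0 u _ w').symm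
  rw [h1, apply_sharpAt_apply (hGm.isInvertible _ u.2), ContinuousLinearMap.coe_coe,
    mvfderiv_chartInv_apply x₀ u hF w']

variable [g.HasLeviCivita]

/-- **The soliton equation read in the chart at `x₀`**: `Ric + Hess f = g/2` on `M` gives
`Ric(G) + Hess_G f̂ = ½ G` on the chart target, `G = chartRep g`, `f̂ = f ∘ (extChartAt I x₀)⁻¹`
(`ricci_comap_apply`, `hessian_comap_apply`, `OpensChart.ricci_eq_ricAt`,
`OpensChart.hessian_eq_hessAt`). [cite: ONeill1983, Ch. 3, Prop. 3.59] -/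
theorem soliton_chartRep (x₀ : M) {f : M → ℝ} (hf : ContMDiff I 𝓘(ℝ, ℝ) ∞ f)
    (hsol : ∀ (x : M) (X Y : TangentSpace I x),
      g.ricci x X Y + g.hessian f x X Y = (1 / 2 : ℝ) * g.val x X Y) :
    ∀ z ∈ (extChartAt I x₀).target, ∀ v w : E,
      ricAt (chartRep I (fun _ ↦ g) x₀ 0) z v w
        + hessAt (chartRep I (fun _ ↦ g) x₀ 0) (f ∘ (extChartAt I x₀).symm) z v w =
      (1 / 2 : ℝ) * chartRep I (fun _ ↦ g) x₀ 0 z v w := by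
  intro z hz v w
  haveI := (chartPullback I g x₀).hasLeviCivita
  have hG := val_chartPullback_eq_chartRep (fun _ : ℝ ↦ g) x₀ 0
  set u : chartTarget I x₀ := ⟨z, hz⟩ with hu
  have hf2 : ContMDiffAt I 𝓘(ℝ, ℝ) 2 f (chartInv I x₀ u) :=
    (hf.of_le (WithTop.coe_le_coe.mpr le_top)).contMDiffAt
  have hrep : ContDiffAt ℝ 2 (f ∘ (extChartAt I x₀).symm) (u : E) := by
    have hsymm : ContMDiffAt 𝓘(ℝ, E) I 2 (extChartAt I x₀).symm (u : E) :=
      (contMDiffOn_extChartAt_symm x₀).contMDiffAt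
        ((isOpen_extChartAt_target x₀).mem_nhds u.2)
    exact contMDiffAt_iff_contDiffAt.1 (hf2.comp (u : E) hsymm)
  have h := hsol (chartInv I x₀ u) (mfderiv 𝓘(ℝ, E) I (chartInv I x₀) u v)
    (mfderiv 𝓘(ℝ, E) I (chartInv I x₀) u w)
  rw [show z = (u : E) from rfl, ← Lorentzian.OpensChart.ricci_eq_ricAt hG u,
    ← Lorentzian.OpensChart.hessian_eq_hessAt hG u (f := f ∘ chartInv I x₀) (fun _ ↦ rfl) hrep,
    g.ricci_comap_apply contMDiff_pullbackBilin_holds (contMDiff_chartInv x₀)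
      (injective_mfderiv_chartInv x₀) rfl u,
    g.hessian_comap_apply contMDiff_pullbackBilin_holds (contMDiff_chartInv x₀)
      (injective_mfderiv_chartInv x₀) rfl hf2, chartRep_apply, val_chartPullback_apply]
  exact h

/-- **Identities (A) and (B) at a point of the chart at `x₀`.** Every tangent vector at `Φ u`
is `dΦ_u v'`; `dR(dΦ v') = DŜ(u) v'` with `Ŝ = scalAt G` the representative of `R`
(`scalarCurvature_chartInv_eq`), `♯df = dΦ(♯_G Df̂)` (`sharp_mvfderiv_chartInv_eq`),
`Ric(dΦ a, dΦ v') = ricAt G u a v'` (`ricci_comap_apply`), `ΔR = lapAt G Ŝ`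
(`dalembertian_chartInv_eq`), `g⁻¹(dR, df) = DŜ(♯_G Df̂)` (`innerDual_chartInv_eq`),
`|Ric|² = normSqAt G (ricAt G)` (`normSq_chartPullback_eq`); then `fderiv_scalAt` and
`lapAt_scalAt`.
[cite: EminentiNaveMantegazza2006, Prop. 2.2] [cite: ChengRibeiroZhou2022, Lemma 1] -/
theorem identities_chartInv (x₀ : M) (u : chartTarget I x₀) {f : M → ℝ}
    (hf : ContMDiff I 𝓘(ℝ, ℝ) ∞ f)
    (hsol : ∀ (x : M) (X Y : TangentSpace I x),
      g.ricci x X Y + g.hessian f x X Y = (1 / 2 : ℝ) * g.val x X Y) :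
    (∀ v : TangentSpace I (chartInv I x₀ u),
      mvfderiv I g.scalarCurvature (chartInv I x₀ u) v =
        2 * g.ricci (chartInv I x₀ u) (g.sharp (chartInv I x₀ u)
          (mvfderiv I f (chartInv I x₀ u) : TangentSpace I (chartInv I x₀ u) →ₗ[ℝ] ℝ)) v) ∧
    g.dalembertian g.scalarCurvature (chartInv I x₀ u) =
      g.innerDual (chartInv I x₀ u)
          (mvfderiv I g.scalarCurvature (chartInv I x₀ u) :
            TangentSpace I (chartInv I x₀ u) →ₗ[ℝ] ℝ)
          (mvfderiv I f (chartInv I x₀ u) : TangentSpace I (chartInv I x₀ u) →ₗ[ℝ] ℝ)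
        + g.scalarCurvature (chartInv I x₀ u)
        - 2 * g.normSq (chartInv I x₀ u) (g.ricci (chartInv I x₀ u)) := by
  set G := chartRep I (fun _ ↦ g) x₀ 0 with hGdef
  haveI := (chartPullback I g x₀).hasLeviCivita
  have hG := val_chartPullback_eq_chartRep (fun _ : ℝ ↦ g) x₀ 0
  have hGm : IsMetricOn G (extChartAt I x₀).target := Lorentzian.OpensChart.isMetricOn_repr hG
  have hφ : ContDiffOn ℝ ∞ (f ∘ (extChartAt I x₀).symm) (extChartAt I x₀).target := by
    rw [← contMDiffOn_iff_contDiffOn]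
    exact hf.comp_contMDiffOn (contMDiffOn_extChartAt_symm x₀)
  have hsol' := soliton_chartRep g x₀ hf hsol
  have hR := g.contMDiff_scalarCurvature
  have hRd : MDifferentiableAt I 𝓘(ℝ, ℝ) g.scalarCurvature (chartInv I x₀ u) :=
    (hR _).mdifferentiableAt (by simp)
  have hR2 : ContMDiffAt I 𝓘(ℝ, ℝ) 2 g.scalarCurvature (chartInv I x₀ u) :=
    (hR _).of_le (WithTop.coe_le_coe.mpr le_top)
  have hfd : MDifferentiableAt I 𝓘(ℝ, ℝ) f (chartInv I x₀ u) := (hf _).mdifferentiableAt (by simp)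
  -- the representative of `R` is `scalAt G` on the target
  have hRrep : (g.scalarCurvature ∘ (extChartAt I x₀).symm) =ᶠ[𝓝 (u : E)] scalAt G := by
    filter_upwards [(isOpen_extChartAt_target x₀).mem_nhds u.2] with z hz
    exact scalarCurvature_chartInv_eq g x₀ ⟨z, hz⟩
  refine ⟨fun v ↦ ?_, ?_⟩
  · -- (A): `v = dΦ v'`
    obtain ⟨v', rfl⟩ : ∃ v' : E, mfderiv 𝓘(ℝ, E) I (chartInv I x₀) u v' = v :=
      ⟨(mfderivEquivOfInjective (I := I) (I' := 𝓘(ℝ, E)) (chartInv I x₀) u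
        (injective_mfderiv_chartInv x₀ u) rfl).symm v,
        mfderiv_mfderivEquivOfInjective_symm _ _ _ _ v⟩
    rw [mvfderiv_chartInv_apply x₀ u hRd v', hRrep.fderiv_eq, sharp_mvfderiv_chartInv_eq g x₀ u hfd,
      ← g.ricci_comap_apply contMDiff_pullbackBilin_holds (contMDiff_chartInv x₀)
        (injective_mfderiv_chartInv x₀) rfl u, Lorentzian.OpensChart.ricci_eq_ricAt hG u]
    exact fderiv_scalAt hGm u.2 hφ hsol' v'
  · -- (B)
    have hnorm : g.normSq (chartInv I x₀ u) (g.ricci (chartInv I x₀ u)) =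
        normSqAt G u (ricAt G u) := by
      rw [← Lorentzian.OpensChart.normSq_ricci_eq_normSqAt hG u,
        normSq_chartPullback_eq g x₀ u _ (g.ricci (chartInv I x₀ u))
          (fun v w ↦ g.ricci_comap_apply contMDiff_pullbackBilin_holds (contMDiff_chartInv x₀)
            (injective_mfderiv_chartInv x₀) rfl u v w)]
    rw [dalembertian_chartInv_eq g x₀ u hR2, lapAt_congr_of_eventuallyEq G hRrep,
      innerDual_chartInv_eq g x₀ u hRd hfd, hRrep.fderiv_eq, scalarCurvature_chartInv_eq g x₀ u,
      hnorm]
    exact lapAt_scalAt hGm u.2 hφ hsol'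

end Transport

end ShrinkerIdentities

/-! ### The registered stub -/

/-- **STUB `stub_shrinkerScalarIdentities` of line `cgy-variance-pivot` — the pointwise
scalar-curvature identities of a gradient shrinker.** On a 4-manifold with Riemannian `g`
(Levi-Civita) and smooth `f` with `Ric + Hess f = g/2`: (A) `dR(v) = 2 Ric(♯df, v)` for every
tangent vector `v`; (B) `ΔR = g⁻¹(dR, df) + R − 2|Ric|²`. From
`ShrinkerIdentities.identities_chartInv` in the chart at each point (valid for any signature
and any boundaryless model; the Riemannian, Hausdorff and second-countability hypotheses are
not used). [cite: EminentiNaveMantegazza2006, Prop. 2.2] [cite: ChengRibeiroZhou2022, Lemma 1] -/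
theorem stub_shrinkerScalarIdentities :
    ∀ (M : Type) [TopologicalSpace M] [T2Space M] [SecondCountableTopology M]
      [ChartedSpace (EuclideanSpace ℝ (Fin 4)) M] [IsManifold (𝓡 4) ∞ M]
      (g : Literature.Geometry.Lorentzian.PseudoRiemannianMetric (𝓡 4) ∞ (EuclideanSpace ℝ (Fin 4))
        (TangentSpace (𝓡 4) : M → Type _)) [g.HasLeviCivita] (f : M → ℝ), g.IsRiemannian →
      ContMDiff (𝓡 4) 𝓘(ℝ, ℝ) ∞ f →
      (∀ (x : M) (X Y : TangentSpace (𝓡 4) x),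
        g.ricci x X Y + g.hessian f x X Y = (1 / 2 : ℝ) * g.val x X Y) →
      (∀ (x : M) (v : TangentSpace (𝓡 4) x),
        mvfderiv (𝓡 4) g.scalarCurvature x v =
          2 * g.ricci x (g.sharp x (mvfderiv (𝓡 4) f x : TangentSpace (𝓡 4) x →ₗ[ℝ] ℝ)) v) ∧
      (∀ x : M, g.dalembertian g.scalarCurvature x =
        g.innerDual x (mvfderiv (𝓡 4) g.scalarCurvature x : TangentSpace (𝓡 4) x →ₗ[ℝ] ℝ)
            (mvfderiv (𝓡 4) f x : TangentSpace (𝓡 4) x →ₗ[ℝ] ℝ) +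
          g.scalarCurvature x - 2 * g.normSq x (g.ricci x)) := by
  intro M _ _ _ _ _ g _ f _ hf hsol
  -- the identities at `x`, read at the point `Φ(φ x) = x` of the chart at `x`
  have key : ∀ x : M, (∀ v : TangentSpace (𝓡 4) x, mvfderiv (𝓡 4) g.scalarCurvature x v =
      2 * g.ricci x (g.sharp x (mvfderiv (𝓡 4) f x : TangentSpace (𝓡 4) x →ₗ[ℝ] ℝ)) v) ∧
      g.dalembertian g.scalarCurvature x =
        g.innerDual x (mvfderiv (𝓡 4) g.scalarCurvature x : TangentSpace (𝓡 4) x →ₗ[ℝ] ℝ)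
            (mvfderiv (𝓡 4) f x : TangentSpace (𝓡 4) x →ₗ[ℝ] ℝ) +
          g.scalarCurvature x - 2 * g.normSq x (g.ricci x) := fun x ↦ by
    have hx : x ∈ (chartAt (EuclideanSpace ℝ (Fin 4)) x).source := mem_chart_source _ x
    have h := ShrinkerIdentities.identities_chartInv g x
      ⟨extChartAt (𝓡 4) x x, (extChartAt (𝓡 4) x).map_source (by rwa [extChartAt_source])⟩
      hf hsol
    rwa [chartInv_extChartAt x hx] at h
  exact ⟨fun x ↦ (key x).1, fun x ↦ (key x).2⟩

end Summit.SmoothPoincare4.SmoothPoincare4.Theorems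

end
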